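import Mathlib
import Summits.Ventures.HodgeRepro2.T5PadicRigidity
import Summits.Ventures.HodgeRepro2.T5DegreeOneValued

/-!
# T5DegreeOneCanonical — the identification `F_𝔭 = ℚ_p` at a degree-one prime is CANONICAL

Tier-5 support (seat p7, cell pub-hodge-repro2) for T5-LEAN-p7.md §22 (b)(iv) / §40–§41 and
CHECK-G S0: the chain T5DegreeOne* produced ONE isomorphism
`completionEquivPadic : w.adicCompletion F ≃+* ℚ_[p]` at a prime `w` of degree one over `p`.
Combined with the rigidity of `ℚ_p` (`T5PadicRigidity.ringHom_eq_id`), this file shows that there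
is NO choice involved: every ring homomorphism `w.adicCompletion F →+* ℚ_[p]` IS that isomorphism
(`ringHom_eq`, `subsingleton_ringHom`, `ringEquiv_eq`), hence is continuous and pulls the `p`-adic
valuation back to the `w`-adic one (`comap_mulValuation_ringHom`), and restricts on `F` to the
chain's embedding `toPadic` (`ringHom_algebraMap`).

So «the p-adic place induced by an embedding» and «the completion at 𝔭 is ℚ_p» (CHECK-G §12.2
rows P1.2 / P1.5 / P1.9) carry no hidden dependence on an identification: the reading of print
is a theorem about the unique map.  Nothing about CM types or Hecke characters is asserted.
-/

namespace Summit.Ventures.HodgeRepro2.T5DegreeOneCanonical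

open IsDedekindDomain NumberField

variable {F : Type*} [Field F] [NumberField F] (w : HeightOneSpectrum (𝓞 F)) (p : ℕ)
  [hp : Fact p.Prime] [hw : w.asIdeal.LiesOver (Ideal.span {(p : ℤ)})]
  (hdeg : w.asIdeal.ramificationIdx ℤ * w.asIdeal.inertiaDeg ℤ = 1)

/-- **Canonicity**: every ring homomorphism from the completion `F_w` to `ℚ_p` is the chain's
isomorphism `completionEquivPadic` (rigidity of `ℚ_p`: `ψ ∘ e⁻¹ : ℚ_p → ℚ_p` is the identity). -/
theorem ringHom_eq (ψ : w.adicCompletion F →+* ℚ_[p]) :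
    ψ = (T5DegreeOneNumberField.completionEquivPadic w p hdeg).toRingHom := by
  set e := T5DegreeOneNumberField.completionEquivPadic w p hdeg with he
  have h : ψ.comp e.symm.toRingHom = RingHom.id ℚ_[p] := T5PadicRigidity.ringHom_eq_id _
  ext x
  have hx := RingHom.congr_fun h (e x)
  simpa using hx

/-- Pointwise form of `ringHom_eq`. -/
theorem ringHom_apply (ψ : w.adicCompletion F →+* ℚ_[p]) (x : w.adicCompletion F) :
    ψ x = T5DegreeOneNumberField.completionEquivPadic w p hdeg x := by
  rw [ringHom_eq w p hdeg ψ]; rfl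

include hdeg in
/-- `F_w` has exactly one ring homomorphism to `ℚ_p`. -/
theorem subsingleton_ringHom : Subsingleton (w.adicCompletion F →+* ℚ_[p]) :=
  ⟨fun ψ ψ' => by rw [ringHom_eq w p hdeg ψ, ringHom_eq w p hdeg ψ']⟩

/-- Every ring isomorphism `F_w ≃+* ℚ_p` is the chain's `completionEquivPadic`. -/
theorem ringEquiv_eq (e' : w.adicCompletion F ≃+* ℚ_[p]) :
    e' = T5DegreeOneNumberField.completionEquivPadic w p hdeg := by
  ext x
  exact ringHom_apply w p hdeg e'.toRingHom x

include hdeg in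
/-- `F_w` has exactly one ring isomorphism onto `ℚ_p`. -/
theorem subsingleton_ringEquiv : Subsingleton (w.adicCompletion F ≃+* ℚ_[p]) :=
  ⟨fun e e' => by rw [ringEquiv_eq w p hdeg e, ringEquiv_eq w p hdeg e']⟩

include hdeg in
/-- Every ring homomorphism `F_w → ℚ_p` is continuous. -/
theorem continuous_ringHom (ψ : w.adicCompletion F →+* ℚ_[p]) : Continuous ψ := by
  rw [ringHom_eq w p hdeg ψ]
  exact T5DegreeOneNumberField.continuous_completionEquivPadic w p hdeg

include hdeg in
/-- Every ring homomorphism `F_w → ℚ_p` pulls the `p`-adic valuation back to the `w`-adic one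
(row 55's `comap_mulValuation_completionEquivPadic` for the unique map). -/
theorem comap_mulValuation_ringHom (ψ : w.adicCompletion F →+* ℚ_[p]) :
    Valuation.comap ψ Padic.mulValuation = Valued.v := by
  rw [ringHom_eq w p hdeg ψ]
  exact T5DegreeOneValued.comap_mulValuation_completionEquivPadic w p hdeg

/-- On `F ⊆ F_w`, every ring homomorphism `F_w → ℚ_p` restricts to the chain's embedding
`toPadic` (row 51). -/
theorem ringHom_algebraMap (ψ : w.adicCompletion F →+* ℚ_[p]) (k : F) :
    ψ (algebraMap F (w.adicCompletion F) k) =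
      T5DegreeOnePadic.toPadic w (T5DegreeOneNumberField.natCast_mem w p)
        (T5DegreeOneNumberField.natCast_notMem_sq w p hdeg)
        (T5DegreeOneNumberField.exists_int_sub_mem w p hdeg) k := by
  rw [ringHom_apply w p hdeg ψ]
  exact T5DegreeOneNumberField.completionEquivPadic_coe w p hdeg k

/-- On `𝓞 F`, every ring homomorphism `F_w → ℚ_p` restricts to the chain's `toPadicInt`
(row 50). -/
theorem ringHom_algebraMap_integers (ψ : w.adicCompletion F →+* ℚ_[p]) (r : 𝓞 F) :
    ψ (algebraMap (𝓞 F) (w.adicCompletion F) r) =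
      ((T5DegreeOnePadicInt.toPadicInt w.ne_bot (T5DegreeOneNumberField.natCast_mem w p)
        (T5DegreeOneNumberField.natCast_notMem_sq w p hdeg)
        (T5DegreeOneNumberField.exists_int_sub_mem w p hdeg)) r : ℚ_[p]) := by
  rw [ringHom_apply w p hdeg ψ]
  exact T5DegreeOneNumberField.completionEquivPadic_algebraMap w p hdeg r

end Summit.Ventures.HodgeRepro2.T5DegreeOneCanonical
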